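import Literature.MathematicalPhysics.QuantumLattice.HubbardTTPrimeCheckerboardSublatticeFloor
import Literature.MathematicalPhysics.QuantumLattice.HubbardTTPrimeBoxTransport
import HarnessLib

/-!
# `t'`-transport WITH `U`-content from the `t = 0` plane: the hopping-sign symmetry `e(-t) = e(t)`,
# the dressed diagonal floor `|s|·e(1, 0, V, n) ≤ e(0, s, |s|V, n)`, and outward `(t', U)` words at the
# interaction-dressed diagonal constant `|e(1, 0, V, n)|` in place of the kinematic `16/π²`

Family `hubbard` (topic `MathematicalPhysics/QuantumLattice`); stage S2 "certifier-families" of the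
Hubbard material-oracle programme (certified energy WORDS over parameter BOXES `(U/t, t'/t, n)`), seat
`hubbard-box-p3` («`t'`-direction Lipschitz / remainder bound so `t'`-boxes transport from the
`t' ∈ {0, -1/4}` anchors»). The object is the thermodynamic-limit ground-state energy density
`e(t, t', U, n) = energyDensityTT' t t' U n` of `H = -t T - t' T' + U D` on `ℤ²`.

The companion files transport a certified floor / cap at an anchor `(t', U) = (s₀, U₀)` OUTWARD in `t'`
at the kinematic price `(16/π²)|Δt'|` (`HubbardTTPrimeDiagHopTransport`, `HubbardTTPrimeBoxTransport` §2–§3: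
the free diagonal band filled to half its depth), through the conic lemma
`e(t, s, U, n) + e(0, δ, W, n) ≤ e(t, s + δ, U + W, n)` used at `W = 0`. The checkerboard file
(`HubbardTTPrimeCheckerboardSublatticeFloor`, box-p1) proved `e(s, 0, W, ρ) ≤ e(0, s, W, ρ)`: the model
with ONLY diagonal hopping dominates the nearest-neighbour model at the same couplings. This file turns
that into transport laws the box emitters can call by name:

* §1 **The sign of the nearest-neighbour hopping is immaterial** (bipartite gauge `c_x ↦ (-1)^{x₁+x₂} c_x`,
  Lieb 1993 §2): on every rectangular torus with even sides and in every particle-number sector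
  `E_{-t,t',U}(N) = E_{t,t',U}(N)` (`groundEnergy_hubbardRectTorusTT'_neg_t`), obtained WITHOUT a new
  unitary by composing the tree's two particle–hole conjugations — Lieb's staggered one
  (`groundEnergy_hubbardRectTorusTT'_particleHole`: `t' ↦ -t'`) and the uniform-sign one
  (`groundEnergy_hubbardRectTorusTT'_particleHole_uniform`: `(t, t') ↦ (-t, -t')`, any sides); hence in the
  thermodynamic limit along the even tori `e(-t, t', U, n) = e(t, t', U, n)` (`energyDensityTT'_neg_t`,
  `U ≥ 0`, `0 ≤ n < 2`).
* §2 **The dressed diagonal floor**: for `V ≥ 0`, `0 < n < 2` and every real `s`,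
  `|s| · e(1, 0, V, n) ≤ e(0, s, |s|V, n)` (`abs_mul_energyDensityTT'_nn_le_diag`; §1 + checkerboard +
  positive homogeneity): every certified `t' = 0` row `ℓ ≤ e(1, 0, V, n)` of the registry is a floor
  `|s|ℓ ≤ e(0, s, |s|V, n)` on the `t = 0` plane, for BOTH signs of `s` (the cuprate sign `s < 0` is the
  one that needs §1). At `V = 0`: `|s|·ℓ₀ ≤ e(0, s, 0, n)` for any certified free floor `ℓ₀ ≤ e(1,0,0,n)` —
  the density-sharp diagonal constant `|ℓ₀(n)|` (`≈ 1.6078` at `n = 7/8`, `≈ 1.52` at `n = 0.7`, vs the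
  density-blind `16/π² ≈ 1.6211`; numbers illustrative, not certified here).
* §3 **Point transport laws with `U`-content.** FLOORS move to larger `U`: `L ≤ e(t, s₀, U₀, n)` and
  `ℓ ≤ e(1, 0, V, n)` give `L + |δ|ℓ ≤ e(t, s₀ + δ, U, n)` for every `U ≥ U₀ + |δ|V`
  (`energyDensityTT'_ge_anchor_add_abs_mul`, `…_of_le`); CAPS move to smaller `U`:
  `e(t, s₀, U₀, n) ≤ R` gives `e(t, s₀ + δ, U, n) ≤ R - |δ|ℓ` for every `0 ≤ U ≤ U₀ - |δ|V`
  (`energyDensityTT'_le_anchor_sub_abs_mul`, `…_of_le`). Target-centred readings (`…_ge_of_columnFloor_diagU`,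
  `…_le_of_columnCap_diagU`): to floor `(s, U)` from the column `s₀`, read the column's floor at
  `U - |s - s₀|V` and pay `|s - s₀|·|ℓ_V|`; `V = 0` is the kinematic law with the density-sharp constant, and
  `V > 0` trades anchor height for a smaller per-unit price (`|e(1,0,V,n)|` decreases in `V`).
* §4 **The `V = 0` laws in the shape of `HubbardTTPrimeBoxTransport` §2**: two-sided Lipschitz
  `|e(t, s, U, n) - e(t, s', U, n)| ≤ |ℓ₀|·|s - s'|` from any certified free floor `ℓ₀ ≤ e(1, 0, 0, n)`
  (`abs_energyDensityTT'_sub_tPrime_le_of_nnFreeFloor`), via the slot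
  `energyDensityTT'_tPrime_transport_ge_of_diagFloor`.
* §5 **Rectangle words.** One anchor `(s₀, U₀)` with floor `L`, a `t'`-interval `[a, b]` with margin
  `m = max (s₀ - a) (b - s₀)` (`≥ |s - s₀|` on `[a, b]`, wherever `s₀` lies), and `ℓ ≤ e(1,0,V,n)`, `ℓ ≤ 0`: `L + m ℓ ≤ e` on `[a, b] × [U₁, U₂]` whenever
  `U₀ + mV ≤ U₁` (`energyDensityTT'_rect_ge_of_anchor_diagU`); cap twin `e ≤ R - m ℓ` on `[a, b] × [U₁, U₂]`
  whenever `U₂ ≤ U₀ - mV` (`energyDensityTT'_rect_le_of_anchor_diagU`) — the `U`-dressed versions of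
  `energyDensityTT'_rect_ge/le_of_anchor_kinematic`.
* §6 **Emitter forms** (`energyDensityTT'_ge_of_anchorFloor_diagU`, `…_le_of_anchorCap_diagU`,
  `…_mem_Icc_of_anchorWindow_diagU`): the anchor read at ANY node `Ua ≤ U - |s - s₀|V` (floor) /
  `Ub ≥ U + |s - s₀|V` (cap), target `(s, U)` literal — the shape the cell emitters instantiate.

Everything is PROVED; no definition, no named fact, no numerical input. HONEST FRAMING: energy-density
transport bookkeeping for certified windows; the gain over the kinematic law is modest at cuprate
densities (per unit `|Δt'|`: `|e(1,0,V,7/8)|` vs `1.6211`, bought by reading the anchor `|Δt'|·V` lower in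
`U`) and nothing here is a statement about superconductivity.

## Mathlib / tree search

REUSED: `groundEnergy_hubbardRectTorusTT'_particleHole` (`HubbardNNNHoppingRectSymmetries`),
`hamiltonian_particleHole_sameSign`, `groundEnergy_particleHole_transfer` (`HubbardNNNHoppingParticleHole`),
`tendsto_energyDensityTT'`, `rectN_le_two_mul`, `energyDensityTT'_nn_le_diag`
(`HubbardTTPrimeCheckerboardSublatticeFloor`), `energyDensityTT'_smul`, `energyDensityTT'_add_ge`
(`HubbardNNNHoppingEnergyDensityRegionBounds`), `energyDensityTT'_mono_U` (`…EnergyDensityMonotone`),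
`energyDensityTT'_tPrime_transport_ge_of_diagFloor` (`HubbardTTPrimeBoxTransport`).
`lean search 'energyDensityTT._neg|energyDensity2D_neg|hamiltonian_neg_t'`: only a private
`hamiltonian_neg_zero` (`U = 0`) — the hopping-sign symmetry of the energy density was not in the tree.

## References

* E. H. Lieb, *The Hubbard model: some rigorous results and open problems*, arXiv:cond-mat/9311033, §2
  (on a bipartite graph the unitary `c_x ↦ (-1)^x c_x` maps `t_{xy} ↦ -t_{xy}`; "for a bipartite graph the
  sign does not matter"). [cite: arXiv9311033, §2]
* F. H. L. Essler et al., *The One-Dimensional Hubbard Model* (2005), §2.2.4 eqs. (2.58)–(2.61) (Shiba /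
  particle–hole transformations; same-sublattice bonds change sign). [cite: EsslerEtAl2005, §2.2.4]
* D. Ruelle, *Statistical Mechanics* (1969), §3.3–§3.4 (thermodynamic limit and variational principle for
  the energy density). [cite: Ruelle1969, §3.3]
* R. B. Israel, *Convexity in the Theory of Lattice Gases* (1979), Thm. I.3.4 (concavity / superadditivity
  of the ground-state energy in the interaction). [cite: Israel1979, Thm. I.3.4]
-/

noncomputable section

open Matrix Finset Filter Topology Set

namespace Literature.MathematicalPhysics.QuantumLattice

open HubbardWave0 Literature.Probability.LatticeModels

/-! ### §1 The sign of the nearest-neighbour hopping is immaterial -/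

section TorusSign

variable {a b : ℕ}

/-- **Uniform-sign particle–hole conjugation of the rectangular `t–t'` sector energies.** For ANY sides
`a, b` and `N ≤ 2ab`: `E_{t,t',U}(2ab - N) = E_{-t,-t',U}(N) - U N + U ab` — the particle–hole unitary with
all signs `+1` flips EVERY hopping amplitude (nearest-neighbour and diagonal bonds alike are "same-sign"
bonds, `hamiltonian_particleHole_sameSign`) and maps the `N`-particle sector onto the `(2ab - N)`-particle
one. [cite: EsslerEtAl2005, §2.2.4 eqs. (2.59)–(2.61)] -/
theorem groundEnergy_hubbardRectTorusTT'_particleHole_uniform (a b : ℕ) (t t' U : ℝ) {N : ℕ}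
    (hN : N ≤ 2 * (a * b)) :
    groundEnergy (hubbardRectTorusTT' a b t t' U) (2 * (a * b) - N) =
      groundEnergy (hubbardRectTorusTT' a b (-t) (-t') U) N - U * N + U * (a * b) := by
  have hcard : Fintype.card (Fin a ×ₗ Fin b) = a * b := card_rectSites a b
  have hn : ∀ i : Orb (Fin a ×ₗ Fin b), ‖(((fun _ : Fin a ×ₗ Fin b => (1 : ℤˣ)) (ofLex i).1 : ℤ) : ℂ)‖ = 1 :=
    fun i => norm_intCast_units _
  have hNN := hamiltonian_particleHole_sameSign (fermionRectTorusGraph a b) t U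
    (fun _ => (1 : ℤˣ)) (fun _ _ _ => rfl)
  have hNNN := hamiltonian_particleHole_sameSign (fermionRectTorusDiagGraph a b) t' 0
    (fun _ => (1 : ℤˣ)) (fun _ _ _ => rfl)
  have key := congrArg₂ (· + ·) hNN hNNN
  simp only [zero_mul, Complex.ofReal_zero, zero_smul, sub_zero, add_zero] at key
  rw [← Matrix.add_mul, ← Matrix.mul_add, ← hubbardRectTorusTT', add_right_comm,
    sub_add_eq_add_sub, ← hubbardRectTorusTT'] at key
  have h := groundEnergy_particleHole_transfer _ hn key (N := N) (by rw [hcard]; exact hN)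
  rw [hcard] at h
  rw [h]
  push_cast
  ring

/-- **The sign of the nearest-neighbour hopping is immaterial on a bipartite torus**: for `a, b` even,
every `N ≤ 2ab` and all `t, t', U`, `E_{-t,t',U}(N) = E_{t,t',U}(N)` — Lieb's staggered particle–hole
conjugation (`t' ↦ -t'`) followed by the uniform one (`(t, t') ↦ (-t, -t')`) is the gauge
`c_{xσ} ↦ (-1)^{x₁+x₂} c_{xσ}`, which flips the nearest-neighbour bonds (opposite sublattices), fixes the
diagonal bonds (same sublattice) and the interaction, and preserves every particle-number sector.
[cite: arXiv9311033, §2] -/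
theorem groundEnergy_hubbardRectTorusTT'_neg_t (ha : Even a) (hb : Even b) (t t' U : ℝ) {N : ℕ}
    (hN : N ≤ 2 * (a * b)) :
    groundEnergy (hubbardRectTorusTT' a b (-t) t' U) N = groundEnergy (hubbardRectTorusTT' a b t t' U) N := by
  have h1 := groundEnergy_hubbardRectTorusTT'_particleHole ha hb t (-t') U hN
  have h2 := groundEnergy_hubbardRectTorusTT'_particleHole_uniform a b t (-t') U hN
  rw [neg_neg] at h1 h2
  linarith

end TorusSign

namespace ThermodynamicLimit

/-- **`e(-t, t', U, n) = e(t, t', U, n)`**: the thermodynamic-limit ground-state energy density of the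
`t–t'` Hubbard model does not depend on the sign of the nearest-neighbour hopping (`U ≥ 0`, `0 ≤ n < 2`;
the defining sequences agree along the even tori, `groundEnergy_hubbardRectTorusTT'_neg_t`). The sign of
`t'` DOES matter away from half filling (`energyDensityTT'_particleHole`). [cite: arXiv9311033, §2] -/
theorem energyDensityTT'_neg_t (t t' : ℝ) {U : ℝ} (hU : 0 ≤ U) {n : ℝ} (hn0 : 0 ≤ n) (hn2 : n < 2) :
    energyDensityTT' (-t) t' U n = energyDensityTT' t t' U n := by
  have h1 := tendsto_energyDensityTT' (-t) t' hU hn0 hn2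
  have h2 := tendsto_energyDensityTT' t t' hU hn0 hn2
  have hT : Tendsto (fun M : ℕ => 2 * M) atTop atTop :=
    Filter.tendsto_id.const_mul_atTop' (by norm_num)
  refine tendsto_nhds_unique (h1.comp hT) ((h2.comp hT).congr fun M => ?_)
  simp only [Function.comp_apply]
  rw [groundEnergy_hubbardRectTorusTT'_neg_t (even_two_mul M) (even_two_mul M) t t' U
    (rectN_le_two_mul hn0 hn2.le (2 * M))]

/-- `e(|t|, t', U, n) = e(t, t', U, n)` (`U ≥ 0`, `0 ≤ n < 2`). [cite: arXiv9311033, §2] -/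
theorem energyDensityTT'_abs_t (t t' : ℝ) {U : ℝ} (hU : 0 ≤ U) {n : ℝ} (hn0 : 0 ≤ n) (hn2 : n < 2) :
    energyDensityTT' |t| t' U n = energyDensityTT' t t' U n := by
  rcases le_total 0 t with ht | ht
  · rw [abs_of_nonneg ht]
  · rw [abs_of_nonpos ht, energyDensityTT'_neg_t t t' hU hn0 hn2]

/-! ### §2 The dressed diagonal floor: `|s|·e(1, 0, V, n) ≤ e(0, s, |s|V, n)` -/

/-- **The `t = 0` plane carries the `t' = 0` rows, with their `U`-content, for both signs of `s`**:
for `V ≥ 0`, `0 < n < 2` and every real `s`, `|s| · e(1, 0, V, n) ≤ e(0, s, |s|V, n)` — checkerboard floor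
`e(s, 0, W, n) ≤ e(0, s, W, n)` at `W = |s|V`, hopping-sign symmetry `e(s,0,W) = e(|s|,0,W)` and positive
homogeneity `e(|s|, 0, |s|V) = |s|·e(1, 0, V)`. So every certified row `ℓ ≤ e(1, 0, V, n)` gives the anchor
`|s|ℓ ≤ e(0, s, |s|V, n)`. [cite: Ruelle1969, §3.3] -/
theorem abs_mul_energyDensityTT'_nn_le_diag (s : ℝ) {V : ℝ} (hV : 0 ≤ V) {n : ℝ} (hn0 : 0 < n)
    (hn2 : n < 2) : |s| * energyDensityTT' 1 0 V n ≤ energyDensityTT' 0 s (|s| * V) n := by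
  have hsV : 0 ≤ |s| * V := mul_nonneg (abs_nonneg s) hV
  have h1 := energyDensityTT'_nn_le_diag s hsV hn0 hn2
  have h2 : energyDensityTT' s 0 (|s| * V) n = energyDensityTT' |s| 0 (|s| * V) n :=
    (energyDensityTT'_abs_t s 0 hsV hn0.le hn2).symm
  have h3 := energyDensityTT'_smul 1 0 hV hn0.le hn2 (abs_nonneg s)
  rw [mul_one, mul_zero] at h3
  linarith

/-- The same floor fed by a certified row: `ℓ ≤ e(1, 0, V, n)` ⇒ `|s|ℓ ≤ e(0, s, |s|V, n)`.
[cite: Ruelle1969, §3.3] -/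
theorem abs_mul_le_energyDensityTT'_diag_of_nnFloor (s : ℝ) {V : ℝ} (hV : 0 ≤ V) {n : ℝ} (hn0 : 0 < n)
    (hn2 : n < 2) {ℓ : ℝ} (hℓ : ℓ ≤ energyDensityTT' 1 0 V n) :
    |s| * ℓ ≤ energyDensityTT' 0 s (|s| * V) n :=
  (mul_le_mul_of_nonneg_left hℓ (abs_nonneg s)).trans (abs_mul_energyDensityTT'_nn_le_diag s hV hn0 hn2)

/-- **Division form**: for `δ ≠ 0` and `W ≥ 0`, `|δ| · e(1, 0, W/|δ|, n) ≤ e(0, δ, W, n)` — the pure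
`δ T' + W D` model at filling `n` is floored by `|δ|` times the square-lattice Hubbard model at coupling
`W/|δ|`. [cite: Ruelle1969, §3.3] -/
theorem abs_mul_energyDensityTT'_nn_div_le_diag {δ : ℝ} (hδ : δ ≠ 0) {W : ℝ} (hW : 0 ≤ W) {n : ℝ}
    (hn0 : 0 < n) (hn2 : n < 2) :
    |δ| * energyDensityTT' 1 0 (W / |δ|) n ≤ energyDensityTT' 0 δ W n := by
  have hδ' : 0 < |δ| := abs_pos.2 hδ
  have h := abs_mul_energyDensityTT'_nn_le_diag δ (div_nonneg hW hδ'.le) hn0 hn2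
  rwa [mul_div_cancel₀ W hδ'.ne'] at h

/-- **The density-sharp diagonal floor** (`V = 0`): any certified free nearest-neighbour floor
`ℓ₀ ≤ e(1, 0, 0, n)` gives `|s|·ℓ₀ ≤ e(0, s, 0, n)` for every `s` — the slot `hD` of
`energyDensityTT'_tPrime_transport_ge_of_diagFloor` with `D = -ℓ₀ = |ℓ₀(n)|` in place of `16/π²`.
[cite: Ruelle1969, §3.3] -/
theorem abs_mul_le_energyDensityTT'_diag_of_nnFreeFloor (s : ℝ) {n : ℝ} (hn0 : 0 < n) (hn2 : n < 2)
    {ℓ₀ : ℝ} (hℓ₀ : ℓ₀ ≤ energyDensityTT' 1 0 0 n) : |s| * ℓ₀ ≤ energyDensityTT' 0 s 0 n := by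
  have h := abs_mul_le_energyDensityTT'_diag_of_nnFloor s le_rfl hn0 hn2 hℓ₀
  rwa [mul_zero] at h

/-! ### §3 Point transport laws with `U`-content -/

/-- **FLOOR transport up-right**: a certified floor `L ≤ e(t, s₀, U₀, n)` (`U₀ ≥ 0`) and a certified
`t' = 0` row `ℓ ≤ e(1, 0, V, n)` (`V ≥ 0`) give `L + |δ|ℓ ≤ e(t, s₀ + δ, U₀ + |δ|V, n)` — conic transport
`e(t, s₀, U₀) + e(0, δ, |δ|V) ≤ e(t, s₀ + δ, U₀ + |δ|V)` with the dressed diagonal floor of §2.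
[cite: Israel1979, Thm. I.3.4] -/
theorem energyDensityTT'_ge_anchor_add_abs_mul (t s₀ δ : ℝ) {U₀ V : ℝ} (hU₀ : 0 ≤ U₀) (hV : 0 ≤ V)
    {n : ℝ} (hn0 : 0 < n) (hn2 : n < 2) {L ℓ : ℝ} (hL : L ≤ energyDensityTT' t s₀ U₀ n)
    (hℓ : ℓ ≤ energyDensityTT' 1 0 V n) :
    L + |δ| * ℓ ≤ energyDensityTT' t (s₀ + δ) (U₀ + |δ| * V) n := by
  have h1 := energyDensityTT'_add_ge t 0 s₀ δ hU₀ (mul_nonneg (abs_nonneg δ) hV) hn0.le hn2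
  rw [add_zero] at h1
  have h2 := abs_mul_le_energyDensityTT'_diag_of_nnFloor δ hV hn0 hn2 hℓ
  linarith

/-- **FLOOR transport up-right, monotone extension**: under the hypotheses of
`energyDensityTT'_ge_anchor_add_abs_mul`, `L + |δ|ℓ ≤ e(t, s₀ + δ, U, n)` for every `U ≥ U₀ + |δ|V`
(`e` is non-decreasing in `U`). [cite: Israel1979, Thm. I.3.4] -/
theorem energyDensityTT'_ge_anchor_add_abs_mul_of_le (t s₀ δ : ℝ) {U₀ V U : ℝ} (hU₀ : 0 ≤ U₀)
    (hV : 0 ≤ V) (hU : U₀ + |δ| * V ≤ U) {n : ℝ} (hn0 : 0 < n) (hn2 : n < 2) {L ℓ : ℝ}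
    (hL : L ≤ energyDensityTT' t s₀ U₀ n) (hℓ : ℓ ≤ energyDensityTT' 1 0 V n) :
    L + |δ| * ℓ ≤ energyDensityTT' t (s₀ + δ) U n :=
  (energyDensityTT'_ge_anchor_add_abs_mul t s₀ δ hU₀ hV hn0 hn2 hL hℓ).trans
    (energyDensityTT'_mono_U t (s₀ + δ) hn0.le hn2
      (add_nonneg hU₀ (mul_nonneg (abs_nonneg δ) hV)) hU)

/-- **FLOOR, target-centred reading**: to floor `e(t, s, U, n)` from the column `t' = s₀`, read the
column's certified floor `L ≤ e(t, s₀, U - |s - s₀|V, n)` LOWER in `U` and pay `|s - s₀|·|ℓ|` with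
`ℓ ≤ e(1, 0, V, n)`: `L + |s - s₀|ℓ ≤ e(t, s, U, n)` (`V ≥ 0`, `|s - s₀|V ≤ U`). `V = 0`: the kinematic law
with the density-sharp constant; `V > 0`: a smaller per-unit price for a lower anchor.
[cite: Israel1979, Thm. I.3.4] -/
theorem energyDensityTT'_ge_of_columnFloor_diagU (t s₀ s : ℝ) {U V : ℝ} (hV : 0 ≤ V)
    (hUV : |s - s₀| * V ≤ U) {n : ℝ} (hn0 : 0 < n) (hn2 : n < 2) {L ℓ : ℝ}
    (hL : L ≤ energyDensityTT' t s₀ (U - |s - s₀| * V) n) (hℓ : ℓ ≤ energyDensityTT' 1 0 V n) :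
    L + |s - s₀| * ℓ ≤ energyDensityTT' t s U n := by
  have h := energyDensityTT'_ge_anchor_add_abs_mul t s₀ (s - s₀) (sub_nonneg.2 hUV) hV hn0 hn2 hL hℓ
  rwa [add_sub_cancel, sub_add_cancel] at h

/-- **CAP transport down-left**: a certified cap `e(t, s₀, U₀, n) ≤ R` and a certified `t' = 0` row
`ℓ ≤ e(1, 0, V, n)` (`V ≥ 0`, `|δ|V ≤ U₀`) give `e(t, s₀ + δ, U₀ - |δ|V, n) ≤ R - |δ|ℓ` — conic transport
read backwards: `e(t, s₀ + δ, U₀ - |δ|V) + e(0, -δ, |δ|V) ≤ e(t, s₀, U₀) ≤ R`.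
[cite: Israel1979, Thm. I.3.4] -/
theorem energyDensityTT'_le_anchor_sub_abs_mul (t s₀ δ : ℝ) {U₀ V : ℝ} (hV : 0 ≤ V)
    (hUV : |δ| * V ≤ U₀) {n : ℝ} (hn0 : 0 < n) (hn2 : n < 2) {R ℓ : ℝ}
    (hR : energyDensityTT' t s₀ U₀ n ≤ R) (hℓ : ℓ ≤ energyDensityTT' 1 0 V n) :
    energyDensityTT' t (s₀ + δ) (U₀ - |δ| * V) n ≤ R - |δ| * ℓ := by
  have hδV : 0 ≤ |δ| * V := mul_nonneg (abs_nonneg δ) hV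
  have h1 := energyDensityTT'_add_ge t 0 (s₀ + δ) (-δ) (sub_nonneg.2 hUV) hδV hn0.le hn2
  rw [add_zero, add_neg_cancel_right, sub_add_cancel] at h1
  have h2 := abs_mul_le_energyDensityTT'_diag_of_nnFloor (-δ) hV hn0 hn2 hℓ
  rw [abs_neg] at h2
  linarith

/-- **CAP transport down-left, monotone extension**: under the hypotheses of
`energyDensityTT'_le_anchor_sub_abs_mul`, `e(t, s₀ + δ, U, n) ≤ R - |δ|ℓ` for every `0 ≤ U ≤ U₀ - |δ|V`.
[cite: Israel1979, Thm. I.3.4] -/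
theorem energyDensityTT'_le_anchor_sub_abs_mul_of_le (t s₀ δ : ℝ) {U₀ V U : ℝ} (hV : 0 ≤ V)
    (hU0 : 0 ≤ U) (hU : U ≤ U₀ - |δ| * V) {n : ℝ} (hn0 : 0 < n) (hn2 : n < 2) {R ℓ : ℝ}
    (hR : energyDensityTT' t s₀ U₀ n ≤ R) (hℓ : ℓ ≤ energyDensityTT' 1 0 V n) :
    energyDensityTT' t (s₀ + δ) U n ≤ R - |δ| * ℓ := by
  have hUV : |δ| * V ≤ U₀ := by linarith
  exact (energyDensityTT'_mono_U t (s₀ + δ) hn0.le hn2 hU0 hU).trans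
    (energyDensityTT'_le_anchor_sub_abs_mul t s₀ δ hV hUV hn0 hn2 hR hℓ)

/-- **CAP, target-centred reading**: to cap `e(t, s, U, n)` (`U ≥ 0`) from the column `t' = s₀`, read the
column's certified cap `e(t, s₀, U + |s - s₀|V, n) ≤ R` HIGHER in `U` and pay `|s - s₀|·|ℓ|` with
`ℓ ≤ e(1, 0, V, n)`: `e(t, s, U, n) ≤ R - |s - s₀|ℓ`. [cite: Israel1979, Thm. I.3.4] -/
theorem energyDensityTT'_le_of_columnCap_diagU (t s₀ s : ℝ) {U V : ℝ} (hV : 0 ≤ V) (hU : 0 ≤ U)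
    {n : ℝ} (hn0 : 0 < n) (hn2 : n < 2) {R ℓ : ℝ}
    (hR : energyDensityTT' t s₀ (U + |s - s₀| * V) n ≤ R) (hℓ : ℓ ≤ energyDensityTT' 1 0 V n) :
    energyDensityTT' t s U n ≤ R - |s - s₀| * ℓ := by
  have hUV : |s - s₀| * V ≤ U + |s - s₀| * V := by linarith
  have h := energyDensityTT'_le_anchor_sub_abs_mul t s₀ (s - s₀) hV hUV hn0 hn2 hR hℓ
  rwa [add_sub_cancel, add_sub_cancel_right] at h

/-- **Window, target-centred**: floor read at `U - |s - s₀|V₁`, cap read at `U + |s - s₀|V₂` on the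
column `s₀` (two possibly different dressing couplings `V₁, V₂ ≥ 0`), rows `ℓ₁ ≤ e(1,0,V₁,n)`,
`ℓ₂ ≤ e(1,0,V₂,n)`: `e(t, s, U, n) ∈ [L + |s - s₀|ℓ₁, R - |s - s₀|ℓ₂]`. [cite: Israel1979, Thm. I.3.4] -/
theorem energyDensityTT'_mem_Icc_of_column_diagU (t s₀ s : ℝ) {U V₁ V₂ : ℝ} (hV₁ : 0 ≤ V₁)
    (hV₂ : 0 ≤ V₂) (hUV : |s - s₀| * V₁ ≤ U) {n : ℝ} (hn0 : 0 < n) (hn2 : n < 2) {L R ℓ₁ ℓ₂ : ℝ}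
    (hL : L ≤ energyDensityTT' t s₀ (U - |s - s₀| * V₁) n)
    (hR : energyDensityTT' t s₀ (U + |s - s₀| * V₂) n ≤ R)
    (hℓ₁ : ℓ₁ ≤ energyDensityTT' 1 0 V₁ n) (hℓ₂ : ℓ₂ ≤ energyDensityTT' 1 0 V₂ n) :
    energyDensityTT' t s U n ∈ Icc (L + |s - s₀| * ℓ₁) (R - |s - s₀| * ℓ₂) :=
  ⟨energyDensityTT'_ge_of_columnFloor_diagU t s₀ s hV₁ hUV hn0 hn2 hL hℓ₁,
    energyDensityTT'_le_of_columnCap_diagU t s₀ s hV₂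
      ((mul_nonneg (abs_nonneg _) hV₁).trans hUV) hn0 hn2 hR hℓ₂⟩

/-! ### §4 The `V = 0` laws: density-sharp Lipschitz transport in `t'` -/

/-- **Density-sharp one-sided transport**: `ℓ₀ ≤ e(1, 0, 0, n)` (any certified free floor at filling
`n`) gives `e(t, s, U, n) + |s' - s|·ℓ₀ ≤ e(t, s', U, n)` for all `s, s'` (`U ≥ 0`, `0 < n < 2`) — the law
`energyDensityTT'_tPrime_transport_ge_of_diagFloor` with `D = -ℓ₀`. [cite: Israel1979, Thm. I.3.4] -/
theorem energyDensityTT'_tPrime_transport_ge_of_nnFreeFloor (t : ℝ) {U : ℝ} (hU : 0 ≤ U) {n : ℝ}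
    (hn0 : 0 < n) (hn2 : n < 2) {ℓ₀ : ℝ} (hℓ₀ : ℓ₀ ≤ energyDensityTT' 1 0 0 n) (s s' : ℝ) :
    energyDensityTT' t s U n + |s' - s| * ℓ₀ ≤ energyDensityTT' t s' U n := by
  have h := energyDensityTT'_tPrime_transport_ge_of_diagFloor t hU hn0.le hn2 (D := -ℓ₀)
    (fun δ => by
      have h' := abs_mul_le_energyDensityTT'_diag_of_nnFreeFloor δ hn0 hn2 hℓ₀
      linarith [mul_comm (|δ|) ℓ₀]) s s'
  linarith [mul_comm (|s' - s|) ℓ₀]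

/-- **Density-sharp two-sided Lipschitz law in `t'`**: `|e(t, s, U, n) - e(t, s', U, n)| ≤ (-ℓ₀)·|s - s'|`
for any certified free floor `ℓ₀ ≤ e(1, 0, 0, n)` (`U ≥ 0`, `0 < n < 2`); `-ℓ₀ = |e_free(n)|` at the exact
free value (`< 16/π²` away from half filling). [cite: Israel1979, Thm. I.3.4] -/
theorem abs_energyDensityTT'_sub_tPrime_le_of_nnFreeFloor (t : ℝ) {U : ℝ} (hU : 0 ≤ U) {n : ℝ}
    (hn0 : 0 < n) (hn2 : n < 2) {ℓ₀ : ℝ} (hℓ₀ : ℓ₀ ≤ energyDensityTT' 1 0 0 n) (s s' : ℝ) :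
    |energyDensityTT' t s U n - energyDensityTT' t s' U n| ≤ -ℓ₀ * |s - s'| := by
  have h1 := energyDensityTT'_tPrime_transport_ge_of_nnFreeFloor t hU hn0 hn2 hℓ₀ s s'
  have h2 := energyDensityTT'_tPrime_transport_ge_of_nnFreeFloor t hU hn0 hn2 hℓ₀ s' s
  rw [abs_sub_comm s' s] at h1
  rw [abs_sub_le_iff]
  constructor <;> nlinarith [abs_nonneg (s - s')]

/-! ### §5 Rectangle words from one anchor at the dressed constant -/

/-- **OUTWARD rectangle FLOOR with `U`-content.** One certified floor `L ≤ e(t, s₀, U₀, n)` (`U₀ ≥ 0`), a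
`t'`-interval `[a, b]` (containing `s₀` or not) with margin `m = max (s₀ - a) (b - s₀) ≥ |s - s₀|`, a row `ℓ ≤ e(1, 0, V, n)` with
`ℓ ≤ 0`, `V ≥ 0`, and a `U`-interval above the dressed anchor, `U₀ + mV ≤ U₁`: then
`L + m ℓ ≤ e(t, s, U, n)` for all `s ∈ [a, b]`, `U ∈ [U₁, U₂]`. (`V = 0`, `ℓ = -16/π²`:
`energyDensityTT'_rect_ge_of_anchor_kinematic` on `U ≥ U₀`.) [cite: Israel1979, Thm. I.3.4] -/
theorem energyDensityTT'_rect_ge_of_anchor_diagU (t : ℝ) {n : ℝ} (hn0 : 0 < n) (hn2 : n < 2)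
    {s₀ U₀ a b U₁ U₂ V L ℓ : ℝ} (hU₀ : 0 ≤ U₀) (hV : 0 ≤ V) (hℓ0 : ℓ ≤ 0)
    (hU₁ : U₀ + max (s₀ - a) (b - s₀) * V ≤ U₁) (hL : L ≤ energyDensityTT' t s₀ U₀ n)
    (hℓ : ℓ ≤ energyDensityTT' 1 0 V n) :
    ∀ s ∈ Icc a b, ∀ U ∈ Icc U₁ U₂, L + max (s₀ - a) (b - s₀) * ℓ ≤ energyDensityTT' t s U n := by
  intro s hs U hU
  have hm : |s - s₀| ≤ max (s₀ - a) (b - s₀) := by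
    rw [abs_le]
    constructor
    · linarith [le_max_left (s₀ - a) (b - s₀), hs.1]
    · linarith [le_max_right (s₀ - a) (b - s₀), hs.2]
  have hUle : U₀ + |s - s₀| * V ≤ U := by
    have : |s - s₀| * V ≤ max (s₀ - a) (b - s₀) * V := mul_le_mul_of_nonneg_right hm hV
    linarith [hU.1]
  have h := energyDensityTT'_ge_anchor_add_abs_mul_of_le t s₀ (s - s₀) hU₀ hV hUle hn0 hn2 hL hℓ
  rw [add_sub_cancel] at h
  have hmono : max (s₀ - a) (b - s₀) * ℓ ≤ |s - s₀| * ℓ := mul_le_mul_of_nonpos_right hm hℓ0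
  linarith

/-- **OUTWARD rectangle CAP with `U`-content.** One certified cap `e(t, s₀, U₀, n) ≤ R`, a `t'`-interval
`[a, b]` with margin `m = max (s₀ - a) (b - s₀)`, a row `ℓ ≤ e(1, 0, V, n)` with `ℓ ≤ 0`, `V ≥ 0`, and a `U`-interval below
the dressed anchor, `0 ≤ U₁`, `U₂ ≤ U₀ - mV`: then `e(t, s, U, n) ≤ R - m ℓ` for all `s ∈ [a, b]`,
`U ∈ [U₁, U₂]`. [cite: Israel1979, Thm. I.3.4] -/
theorem energyDensityTT'_rect_le_of_anchor_diagU (t : ℝ) {n : ℝ} (hn0 : 0 < n) (hn2 : n < 2)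
    {s₀ U₀ a b U₁ U₂ V R ℓ : ℝ} (hV : 0 ≤ V) (hℓ0 : ℓ ≤ 0) (hU₁ : 0 ≤ U₁)
    (hU₂ : U₂ ≤ U₀ - max (s₀ - a) (b - s₀) * V) (hR : energyDensityTT' t s₀ U₀ n ≤ R)
    (hℓ : ℓ ≤ energyDensityTT' 1 0 V n) :
    ∀ s ∈ Icc a b, ∀ U ∈ Icc U₁ U₂, energyDensityTT' t s U n ≤ R - max (s₀ - a) (b - s₀) * ℓ := by
  intro s hs U hU
  have hm : |s - s₀| ≤ max (s₀ - a) (b - s₀) := by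
    rw [abs_le]
    constructor
    · linarith [le_max_left (s₀ - a) (b - s₀), hs.1]
    · linarith [le_max_right (s₀ - a) (b - s₀), hs.2]
  have hUle : U ≤ U₀ - |s - s₀| * V := by
    have : |s - s₀| * V ≤ max (s₀ - a) (b - s₀) * V := mul_le_mul_of_nonneg_right hm hV
    linarith [hU.2]
  have h := energyDensityTT'_le_anchor_sub_abs_mul_of_le t s₀ (s - s₀) hV (hU₁.trans hU.1) hUle hn0
    hn2 hR hℓ
  rw [add_sub_cancel] at h
  have hmono : max (s₀ - a) (b - s₀) * ℓ ≤ |s - s₀| * ℓ := mul_le_mul_of_nonpos_right hm hℓ0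
  linarith

/-- **OUTWARD rectangle WINDOW with `U`-content** from ONE windowed anchor `L ≤ e(t, s₀, U₀, n) ≤ R`:
on `[a, b] × [U₁, U₂]` with `U₀ + mV₁ ≤ U₁`, `U₂ ≤ U₀ - mV₂`, i.e. — for `V₁ = V₂ = 0` — on the COLUMN
SEGMENT `U₁ = U₂ = U₀` only; the general case serves two different anchors through the one-sided
theorems. Stated for the common degenerate use `V₁ = V₂ = 0` (density-sharp kinematic window on the
anchor's own `U`-row): `e ∈ [L + m ℓ₀, R - m ℓ₀]` on `[a, b] × {U₀}`. [cite: Israel1979, Thm. I.3.4] -/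
theorem energyDensityTT'_tPrime_mem_Icc_of_anchor_nnFreeFloor (t : ℝ) {n : ℝ} (hn0 : 0 < n) (hn2 : n < 2)
    {s₀ U₀ a b L R ℓ₀ : ℝ} (hU₀ : 0 ≤ U₀) (hℓ0 : ℓ₀ ≤ 0)
    (hL : L ≤ energyDensityTT' t s₀ U₀ n) (hR : energyDensityTT' t s₀ U₀ n ≤ R)
    (hℓ : ℓ₀ ≤ energyDensityTT' 1 0 0 n) :
    ∀ s ∈ Icc a b, energyDensityTT' t s U₀ n ∈
      Icc (L + max (s₀ - a) (b - s₀) * ℓ₀) (R - max (s₀ - a) (b - s₀) * ℓ₀) := by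
  intro s hs
  have hmem : U₀ ∈ Icc U₀ U₀ := ⟨le_rfl, le_rfl⟩
  refine ⟨energyDensityTT'_rect_ge_of_anchor_diagU t hn0 hn2 hU₀ le_rfl hℓ0
      (by rw [mul_zero, add_zero]) hL hℓ s hs U₀ hmem,
    energyDensityTT'_rect_le_of_anchor_diagU t hn0 hn2 le_rfl hℓ0 hU₀
      (by rw [mul_zero, sub_zero]) hR hℓ s hs U₀ hmem⟩

/-! ### §6 Emitter forms: anchor read at ANY node below / above the dressed height -/

/-- **FLOOR, emitter form.** A certified floor `L ≤ e(t, s₀, Ua, n)` at ANY node `Ua ≥ 0` of the column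
`s₀` with `Ua + |s - s₀|·V ≤ U`, and a `t' = 0` row `ℓ ≤ e(1, 0, V, n)` (`V ≥ 0`), give
`L + |s - s₀|·ℓ ≤ e(t, s, U, n)` — the target `(s, U)` literal, monotonicity in `U` folded in (the shape the
cell emitters instantiate with registry hypotheses `q ≤ energyDensityTT' 1 s₀ Ua n`).
[cite: Israel1979, Thm. I.3.4] -/
theorem energyDensityTT'_ge_of_anchorFloor_diagU (t s₀ s : ℝ) {Ua U V : ℝ} (hUa : 0 ≤ Ua) (hV : 0 ≤ V)
    (hU : Ua + |s - s₀| * V ≤ U) {n : ℝ} (hn0 : 0 < n) (hn2 : n < 2) {L ℓ : ℝ}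
    (hL : L ≤ energyDensityTT' t s₀ Ua n) (hℓ : ℓ ≤ energyDensityTT' 1 0 V n) :
    L + |s - s₀| * ℓ ≤ energyDensityTT' t s U n := by
  have h := energyDensityTT'_ge_anchor_add_abs_mul_of_le t s₀ (s - s₀) hUa hV hU hn0 hn2 hL hℓ
  rwa [add_sub_cancel] at h

/-- **CAP, emitter form.** A certified cap `e(t, s₀, Ua, n) ≤ R` at ANY node `Ua` of the column `s₀` with
`U + |s - s₀|·V ≤ Ua` (`U ≥ 0`), and a `t' = 0` row `ℓ ≤ e(1, 0, V, n)` (`V ≥ 0`), give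
`e(t, s, U, n) ≤ R - |s - s₀|·ℓ`. [cite: Israel1979, Thm. I.3.4] -/
theorem energyDensityTT'_le_of_anchorCap_diagU (t s₀ s : ℝ) {Ua U V : ℝ} (hV : 0 ≤ V) (hU0 : 0 ≤ U)
    (hU : U + |s - s₀| * V ≤ Ua) {n : ℝ} (hn0 : 0 < n) (hn2 : n < 2) {R ℓ : ℝ}
    (hR : energyDensityTT' t s₀ Ua n ≤ R) (hℓ : ℓ ≤ energyDensityTT' 1 0 V n) :
    energyDensityTT' t s U n ≤ R - |s - s₀| * ℓ := by
  have h := energyDensityTT'_le_anchor_sub_abs_mul_of_le t s₀ (s - s₀) hV hU0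
    (by linarith : U ≤ Ua - |s - s₀| * V) hn0 hn2 hR hℓ
  rwa [add_sub_cancel] at h

/-- **WINDOW, emitter form**: floor node `Ua` (below) and cap node `Ub` (above) on the column `s₀`, dressing
couplings `V₁, V₂ ≥ 0` with rows `ℓ₁ ≤ e(1,0,V₁,n)`, `ℓ₂ ≤ e(1,0,V₂,n)`, `Ua + |s - s₀|V₁ ≤ U`,
`U + |s - s₀|V₂ ≤ Ub`: `e(t, s, U, n) ∈ [L + |s - s₀|ℓ₁, R - |s - s₀|ℓ₂]`. [cite: Israel1979, Thm. I.3.4] -/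
theorem energyDensityTT'_mem_Icc_of_anchorWindow_diagU (t s₀ s : ℝ) {Ua Ub U V₁ V₂ : ℝ} (hUa : 0 ≤ Ua)
    (hV₁ : 0 ≤ V₁) (hV₂ : 0 ≤ V₂) (hU₁ : Ua + |s - s₀| * V₁ ≤ U) (hU₂ : U + |s - s₀| * V₂ ≤ Ub) {n : ℝ}
    (hn0 : 0 < n) (hn2 : n < 2) {L R ℓ₁ ℓ₂ : ℝ} (hL : L ≤ energyDensityTT' t s₀ Ua n)
    (hR : energyDensityTT' t s₀ Ub n ≤ R) (hℓ₁ : ℓ₁ ≤ energyDensityTT' 1 0 V₁ n)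
    (hℓ₂ : ℓ₂ ≤ energyDensityTT' 1 0 V₂ n) :
    energyDensityTT' t s U n ∈ Icc (L + |s - s₀| * ℓ₁) (R - |s - s₀| * ℓ₂) :=
  ⟨energyDensityTT'_ge_of_anchorFloor_diagU t s₀ s hUa hV₁ hU₁ hn0 hn2 hL hℓ₁,
    energyDensityTT'_le_of_anchorCap_diagU t s₀ s hV₂
      (hUa.trans ((le_add_of_nonneg_right (mul_nonneg (abs_nonneg _) hV₁)).trans hU₁)) hU₂ hn0 hn2 hR hℓ₂⟩

end ThermodynamicLimit

end Literature.MathematicalPhysics.QuantumLattice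

end
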